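import Summits.QuantumFields.YangMills.Theorems.AlphaInputsT3ACv3TubeGraft
import HarnessLib

/-!
# `AlphaInputsT3ACv3StartAssembly` — START v3.1 for the (FL) `hLift` binder, row (S5), part 4a: **THE START FIELD OVER AN ABSTRACT TUBE∕BALL SYSTEM**, in two stages —
# (T) `tubeSec` := the tube graft of `Q` on the bonds where it differs from the section, `iterSec k V` elsewhere; (B) `ballGraft … W` := `ballU v` on the bonds of ball `v`, `W`
# elsewhere; `startU := ballGraft … tubeSec`.  Under separation∕coverage hypotheses stated relative to a predicate `C` of «constrained» fine plaquettes, ★★ every constrained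
# plaquette has `dist1 (startU(∂q)) ≤ max(b_T, b_B)`, and `startU = iterSec k V` off the balls and the active tube bonds — lane `pub-balaban3d` ∕ cell `ym3-torus`, seat
# `ym-ust-19936-w1` (g2, LEAD)

WHY (bus START v3.1 02:53Z/03:02Z).  The canonical START of the regional Newton scheme is the section `iterSec k V` with (T) one-quadrant tubes grafted along the interior edges
(`…v3TubeGraft`) and (B) transfinite-filled cubes at the interior vertices (★w5 (S3) + ★w3 (S4)), the cubes being filled from the boundary data OF STAGE (T).  THIS FILE is the
analytic half of the assembly, with the lattice combinatorics of the region abstracted into hypotheses.  Stage (T), for a predicate `C` of plaquettes: (A3) a `C`-plaquette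
touching an ACTIVE bond of tube `Q` (one where the graft differs from the section) lies in `Q`'s chart box with all four corners; (A4) two tubes active on bonds of one
`C`-plaquette coincide; (A5) a `C`-plaquette on which the section is not flat touches an active bond.  Stage (B): balls are disjoint; a `C`-plaquette DEEP in a ball (all four
bonds) has a `b_B`-flat ball plaquette; on a bond of a ball lying on a `C`-plaquette that is NOT deep the ball field agrees with the base field (boundary agreement of the
filling).  The final theorem applies (T) to the predicate `C ∧ ¬Deep`.  Part 4b (the canonical system of a block-saturated region satisfies these with `C = (· ∈ plaqsIn 0 Ω)`:
the constrained plaquettes have ALL FOUR corners in `Ω`, `B10Eq38TorusDomains.plaqsIn`) and part 3 (the ball fields) are separate files.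
WHAT IS HERE: §1 `Plaq.HasBond`, `plaqHol_congr`; §2 `tubeField`, `TubeActive`, `tubeSec` (defs), `tubeField_eq_iterSec_of_forall`, `exists_chart_of_tubeActive`,
`tubeSec_eq_tubeField`, `tubeSec_apply_of_quiet`, ★`plaqHol_tubeSec_eq_of_active`, `plaqHol_tubeSec_eq_one_of_quiet`, ★★`dist1_plaqHol_tubeSec_le`; §3 `Plaq.Deep`, `ballGraft`
(defs), `ballGraft_apply_of_ball`, `ballGraft_apply_of_not`, `plaqHol_ballGraft_eq_of_deep`, `plaqHol_ballGraft_eq_of_not_deep`, ★★`dist1_plaqHol_ballGraft_le`; §4 `startU`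
(def), ★★★`dist1_plaqHol_startU_le`, `startU_apply_of_quiet`, `startU_apply_of_ball`, `startU_apply_of_not_ball`.
HONEST FRAMING.  Bookkeeping over part 2; no estimate beyond `max`; (FL)∕`hLift` NOT proved; count-neutral helper toward R3 2′ (items 19936∕19935); registry untouched; nothing about
d = 4, the continuum, or a mass gap; YM₃ on T³ is rung R3, not Clay.

References: T. Bałaban, Commun. Math. Phys. 102 (1985) 277–309 [Balaban1985Variational] ((11)–(14) pp.279–280); Commun. Math. Phys. 98 (1985) 17–51 [Balaban1985Averaging]
((9), (12) p.19).
-/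

set_option autoImplicit false

noncomputable section

open scoped Matrix.Norms.L2Operator

namespace Summit.QuantumFields.YangMills.Theorems.TubeStart

open Literature.MathematicalPhysics.QuantumFieldTheory.Balaban1983to89
open Literature.MathematicalPhysics.QuantumFieldTheory.Balaban1983to89.T4AdjointCovarianceUnitary (lieSU expSU)
open Literature.MathematicalPhysics.QuantumFieldTheory.Balaban1983to89.BlockAveragingSectionAction (iterSec)
open Summit.QuantumFields.Balaban3D.Carriers
open Summit.QuantumFields.YangMills.Theorems.ModelBox

/-! ## §1 The four bonds of a plaquette -/

section Bonds

variable {P : Params} {j : ℕ} {G : Type*} [GaugeGroup G]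

/-- `b` is one of the four bonds of the plaquette `q`. [cite: Balaban1985Averaging, (9) p.19] -/
def Plaq.HasBond (q : Plaq P j) (b : PBond P j) : Prop :=
  b = ⟨q.src, q.μ⟩ ∨ b = ⟨q.src.shift q.μ, q.ν⟩ ∨ b = ⟨q.src.shift q.ν, q.μ⟩ ∨ b = ⟨q.src, q.ν⟩

/-- Two fields agreeing on the four bonds of `q` have the same plaquette variable at `q`. [cite: Balaban1985Averaging, (9) p.19] -/
theorem plaqHol_congr {U U' : GaugeField P j G} (q : Plaq P j) (h : ∀ b, Plaq.HasBond q b → U b = U' b) :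
    GaugeField.plaqHol U q = GaugeField.plaqHol U' q := by
  simp only [GaugeField.plaqHol]
  rw [h _ (Or.inl rfl), h _ (Or.inr (Or.inl rfl)), h _ (Or.inr (Or.inr (Or.inl rfl))), h _ (Or.inr (Or.inr (Or.inr rfl)))]

end Bonds

/-! ## §2 Stage (T): tubes grafted into the section -/

section Tubes

variable {P : Params} {n : Type*} [Fintype n] [DecidableEq n] [Nonempty n] {k : ℕ}

/-- **THE TUBE FIELD OF A COARSE PLAQUETTE** `Q = (y; μ, ν)` with logarithm `F′_Q` and transverse form `t_Q`: the graft of the model tube along the whole edge (transverse half-width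
`Rt`, longitudinal half-width `⌊L^k∕2⌋`). [cite: Balaban1985Variational, (11) p.279] -/
def tubeField (k : ℕ) (V : GaugeField P k (Matrix.specialUnitaryGroup n ℂ)) (Rt : ℕ) (Fp : Plaq P k → lieSU n) (tf : Plaq P k → (Fin P.d → ℤ) → Fin P.d → ℝ)
    (Q : Plaq P k) : GaugeField P 0 (Matrix.specialUnitaryGroup n ℂ) :=
  graft (cornerSite k Q.src Q.μ Q.ν) Q.μ Q.ν Rt (P.L ^ k / 2)
    (tubeU Q.μ Q.ν (V ⟨Q.src, Q.μ⟩) (V ⟨Q.src.shift Q.μ, Q.ν⟩) (V ⟨Q.src, Q.ν⟩) (Fp Q) (tf Q)) (iterSec k V)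

variable (V : GaugeField P k (Matrix.specialUnitaryGroup n ℂ)) (Rt : ℕ) (Fp : Plaq P k → lieSU n) (tf : Plaq P k → (Fin P.d → ℤ) → Fin P.d → ℝ)
  (IsTube : Plaq P k → Prop)

/-- **OFF THE PROFILE THE TUBE FIELD IS THE SECTION**: if `t_Q` agrees with the string indicator at every chart preimage of `b`, then `tubeField Q b = iterSec k V b`.
[cite: Balaban1985Variational, (11) p.279] -/
theorem tubeField_eq_iterSec_of_forall (hk : k ≤ P.m + P.K) {Q : Plaq P k} (hRt : Rt + 2 ≤ P.L ^ k) (hN : 2 * max Rt (P.L ^ k / 2) + 1 ≤ P.sitesPerDir 0)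
    (hF : expSU (Fp Q) = V ⟨Q.src, Q.ν⟩ * V ⟨Q.src.shift Q.ν, Q.μ⟩ * (V ⟨Q.src.shift Q.μ, Q.ν⟩)⁻¹ * (V ⟨Q.src, Q.μ⟩)⁻¹) (b : PBond P 0)
    (h : ∀ u, InTube Q.μ Q.ν Rt (P.L ^ k / 2) u → InTube Q.μ Q.ν Rt (P.L ^ k / 2) (u + e b.dir) → boxSite (cornerSite k Q.src Q.μ Q.ν) u = b.src →
      tf Q u b.dir = stringInd Q.μ Q.ν u b.dir) :
    tubeField k V Rt Fp tf Q b = iterSec k V b := by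
  classical
  unfold tubeField
  by_cases hb : TubeBond (cornerSite k Q.src Q.μ Q.ν) Q.μ Q.ν Rt (P.L ^ k / 2) b
  · obtain ⟨u, hu, hu', hsrc⟩ := hb
    cases b with
    | mk src dir =>
      simp only at hsrc hu' h
      subst hsrc
      exact graft_tubeU_apply_eq_iterSec hk Q.src (ne_of_lt Q.hμν) hRt hN V (Fp Q) hF (tf Q) hu hu' (h u hu hu' rfl)
  · exact graft_apply_of_not _ _ _ _ _ hb

/-- **A TUBE IS ACTIVE ON A BOND** iff it is one of the system's tubes and its graft differs from the section there. [folklore] -/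
def TubeActive (Q : Plaq P k) (b : PBond P 0) : Prop := IsTube Q ∧ tubeField k V Rt Fp tf Q b ≠ iterSec k V b

/-- An active bond is a charted tube bond at a point where `t_Q ≠ s`. [cite: Balaban1985Variational, (11) p.279] -/
theorem exists_chart_of_tubeActive (hk : k ≤ P.m + P.K) {Q : Plaq P k} (hRt : Rt + 2 ≤ P.L ^ k) (hN : 2 * max Rt (P.L ^ k / 2) + 1 ≤ P.sitesPerDir 0)
    (hF : expSU (Fp Q) = V ⟨Q.src, Q.ν⟩ * V ⟨Q.src.shift Q.ν, Q.μ⟩ * (V ⟨Q.src.shift Q.μ, Q.ν⟩)⁻¹ * (V ⟨Q.src, Q.μ⟩)⁻¹) {b : PBond P 0}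
    (hb : TubeActive V Rt Fp tf IsTube Q b) :
    ∃ u, InTube Q.μ Q.ν Rt (P.L ^ k / 2) u ∧ InTube Q.μ Q.ν Rt (P.L ^ k / 2) (u + e b.dir) ∧ boxSite (cornerSite k Q.src Q.μ Q.ν) u = b.src ∧
      tf Q u b.dir ≠ stringInd Q.μ Q.ν u b.dir := by
  by_contra hne
  refine hb.2 (tubeField_eq_iterSec_of_forall V Rt Fp tf hk hRt hN hF b fun u hu hu' hsrc => ?_)
  by_contra ht
  exact hne ⟨u, hu, hu', hsrc, ht⟩

open Classical in
/-- **STAGE (T) — TUBES GRAFTED INTO THE SECTION**: an active tube's graft on its active bonds, the section elsewhere. [cite: Balaban1985Variational, (11) p.279] -/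
def tubeSec : GaugeField P 0 (Matrix.specialUnitaryGroup n ℂ) := fun b =>
  if h : ∃ Q, TubeActive V Rt Fp tf IsTube Q b then tubeField k V Rt Fp tf (Classical.choose h) b else iterSec k V b

/-- If `Q` is a tube of the system and every tube active on `b` is `Q`, stage (T) is `Q`'s tube field at `b` (whether or not `Q` is active there). [folklore] -/
theorem tubeSec_eq_tubeField {b : PBond P 0} {Q : Plaq P k} (hQ : IsTube Q) (huniq : ∀ Q', TubeActive V Rt Fp tf IsTube Q' b → Q' = Q) :
    tubeSec V Rt Fp tf IsTube b = tubeField k V Rt Fp tf Q b := by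
  classical
  unfold tubeSec
  by_cases h' : ∃ Q', TubeActive V Rt Fp tf IsTube Q' b
  · rw [dif_pos h', huniq _ (Classical.choose_spec h')]
  · rw [dif_neg h']
    by_contra hne
    exact h' ⟨Q, hQ, fun heq => hne heq.symm⟩

/-- Off every active bond stage (T) is the section. [cite: Balaban1985Variational, (11) p.279] -/
theorem tubeSec_apply_of_quiet {b : PBond P 0} (hna : ¬ ∃ Q, TubeActive V Rt Fp tf IsTube Q b) : tubeSec V Rt Fp tf IsTube b = iterSec k V b := by
  classical
  unfold tubeSec
  rw [dif_neg hna]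

variable (C : Plaq P 0 → Prop)

/-- **★ A `C`-PLAQUETTE TOUCHING AN ACTIVE BOND OF `Q` IS `Q`'S TUBE PLAQUETTE** (tubes separated on `C`-plaquettes). [cite: Balaban1985Variational, (11) p.279] -/
theorem plaqHol_tubeSec_eq_of_active
    (hsep : ∀ Q Q' q, C q → (∃ b, Plaq.HasBond q b ∧ TubeActive V Rt Fp tf IsTube Q b) → (∃ b, Plaq.HasBond q b ∧ TubeActive V Rt Fp tf IsTube Q' b) → Q = Q')
    {q : Plaq P 0} (hq : C q) {Q : Plaq P k} {b : PBond P 0} (hqb : Plaq.HasBond q b) (hact : TubeActive V Rt Fp tf IsTube Q b) :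
    GaugeField.plaqHol (tubeSec V Rt Fp tf IsTube) q = GaugeField.plaqHol (tubeField k V Rt Fp tf Q) q :=
  plaqHol_congr q fun b' hb' =>
    tubeSec_eq_tubeField V Rt Fp tf IsTube hact.1 fun Q' hQ' => (hsep Q Q' q hq ⟨b, hqb, hact⟩ ⟨b', hb', hQ'⟩).symm

/-- **A `C`-PLAQUETTE TOUCHING NO ACTIVE BOND IS TRIVIAL** when the section's non-flat `C`-plaquettes are covered by active bonds. [cite: Balaban1985Averaging, (12) p.19] -/
theorem plaqHol_tubeSec_eq_one_of_quiet
    (hcov : ∀ q, C q → GaugeField.plaqHol (iterSec k V) q ≠ 1 → ∃ Q b, Plaq.HasBond q b ∧ TubeActive V Rt Fp tf IsTube Q b)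
    {q : Plaq P 0} (hq : C q) (hA : ¬ ∃ Q b, Plaq.HasBond q b ∧ TubeActive V Rt Fp tf IsTube Q b) :
    GaugeField.plaqHol (tubeSec V Rt Fp tf IsTube) q = 1 := by
  have heq : GaugeField.plaqHol (tubeSec V Rt Fp tf IsTube) q = GaugeField.plaqHol (iterSec k V) q :=
    plaqHol_congr q fun b' hb' => tubeSec_apply_of_quiet V Rt Fp tf IsTube fun ⟨Q, hQ⟩ => hA ⟨Q, b', hb', hQ⟩
  rw [heq]
  by_contra hne
  exact hA (hcov q hq hne)

/-- **★★ STAGE (T): EVERY `C`-PLAQUETTE IS `b_T`-FLAT** under (A3) box containment of the `C`-plaquettes touching an active bond, (A4) separation, (A5) coverage, and the tube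
budget `exp(|curlB t_Q|·‖F′_Q‖) − 1 ≤ b_T`. [cite: Balaban1985Variational, (11)–(14) pp.279–280] -/
theorem dist1_plaqHol_tubeSec_le (hN : 2 * max Rt (P.L ^ k / 2) + 1 ≤ P.sitesPerDir 0) {bT : ℝ} (hbT : 0 ≤ bT)
    (hbox : ∀ Q, IsTube Q → ∀ q, C q → (∃ b, Plaq.HasBond q b ∧ TubeActive V Rt Fp tf IsTube Q b) →
      ∃ u : Fin P.d → ℤ, q.src = boxSite (cornerSite k Q.src Q.μ Q.ν) u ∧ InTube Q.μ Q.ν Rt (P.L ^ k / 2) u ∧ InTube Q.μ Q.ν Rt (P.L ^ k / 2) (u + e q.μ) ∧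
        InTube Q.μ Q.ν Rt (P.L ^ k / 2) (u + e q.ν) ∧ InTube Q.μ Q.ν Rt (P.L ^ k / 2) (u + e q.μ + e q.ν))
    (hsep : ∀ Q Q' q, C q → (∃ b, Plaq.HasBond q b ∧ TubeActive V Rt Fp tf IsTube Q b) → (∃ b, Plaq.HasBond q b ∧ TubeActive V Rt Fp tf IsTube Q' b) → Q = Q')
    (hcov : ∀ q, C q → GaugeField.plaqHol (iterSec k V) q ≠ 1 → ∃ Q b, Plaq.HasBond q b ∧ TubeActive V Rt Fp tf IsTube Q b)
    (htube : ∀ Q, IsTube Q → ∀ u α β, Real.exp (|curlB (tf Q) u α β| * ‖((Fp Q : lieSU n) : Matrix n n ℂ)‖) - 1 ≤ bT)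
    (q : Plaq P 0) (hq : C q) :
    GaugeGroup.dist1 (GaugeField.plaqHol (tubeSec V Rt Fp tf IsTube) q) ≤ bT := by
  classical
  by_cases hA : ∃ Q b, Plaq.HasBond q b ∧ TubeActive V Rt Fp tf IsTube Q b
  · obtain ⟨Q, b, hqb, hact⟩ := hA
    rw [plaqHol_tubeSec_eq_of_active V Rt Fp tf IsTube C hsep hq hqb hact]
    obtain ⟨u, hsrc, h00, h10, h01, h11⟩ := hbox Q hact.1 q hq ⟨b, hqb, hact⟩
    have hq' : q = ⟨boxSite (cornerSite k Q.src Q.μ Q.ν) u, q.μ, q.ν, q.hμν⟩ := by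
      cases q
      simp only at hsrc
      subst hsrc
      rfl
    rw [hq']
    unfold tubeField
    exact (dist1_plaqHol_graft_tubeU_le Q.src hN V (Fp Q) (tf Q) q.hμν h00 h10 h01 h11).trans (htube Q hact.1 u q.μ q.ν)
  · rw [plaqHol_tubeSec_eq_one_of_quiet V Rt Fp tf IsTube C hcov hq hA, GaugeGroup.dist1_one]
    exact hbT

end Tubes

/-! ## §3 Stage (B): ball fields grafted into a base field -/

section Balls

variable {P : Params} {G : Type*}

/-- A plaquette is DEEP in the ball system iff all four of its bonds are bonds of one ball. [folklore] -/
def Plaq.Deep (IsBall : Site P 0 → Prop) (InBall : Site P 0 → PBond P 0 → Prop) (q : Plaq P 0) : Prop :=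
  ∃ v, IsBall v ∧ ∀ b, Plaq.HasBond q b → InBall v b

variable (IsBall : Site P 0 → Prop) (InBall : Site P 0 → PBond P 0 → Prop) (ballU : Site P 0 → GaugeField P 0 G) (W : GaugeField P 0 G)

open Classical in
/-- **STAGE (B) — BALL FIELDS GRAFTED INTO A BASE FIELD `W`**: `ballU v` on the bonds of ball `v`, `W` elsewhere. [cite: Balaban1985Variational, (11) p.279] -/
def ballGraft : GaugeField P 0 G := fun b => if h : ∃ v, IsBall v ∧ InBall v b then ballU (Classical.choose h) b else W b

/-- On a bond of ball `v` (balls disjoint) the graft is the ball field. [folklore] -/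
theorem ballGraft_apply_of_ball (hdisj : ∀ v v' b, IsBall v → IsBall v' → InBall v b → InBall v' b → v = v') {v : Site P 0} {b : PBond P 0} (hv : IsBall v)
    (hb : InBall v b) : ballGraft IsBall InBall ballU W b = ballU v b := by
  classical
  have h : ∃ v, IsBall v ∧ InBall v b := ⟨v, hv, hb⟩
  unfold ballGraft
  rw [dif_pos h]
  obtain ⟨hv', hb'⟩ := Classical.choose_spec h
  rw [hdisj _ _ b hv' hv hb' hb]

/-- Off the balls the graft is the base field. [folklore] -/
theorem ballGraft_apply_of_not {b : PBond P 0} (h : ¬ ∃ v, IsBall v ∧ InBall v b) : ballGraft IsBall InBall ballU W b = W b := by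
  classical
  unfold ballGraft
  rw [dif_neg h]

variable [GaugeGroup G]

/-- A plaquette deep in ball `v` is `v`'s ball plaquette. [cite: Balaban1985Averaging, (9) p.19] -/
theorem plaqHol_ballGraft_eq_of_deep (hdisj : ∀ v v' b, IsBall v → IsBall v' → InBall v b → InBall v' b → v = v') {v : Site P 0} (hv : IsBall v) {q : Plaq P 0}
    (hq : ∀ b, Plaq.HasBond q b → InBall v b) : GaugeField.plaqHol (ballGraft IsBall InBall ballU W) q = GaugeField.plaqHol (ballU v) q :=
  plaqHol_congr q fun b hb => ballGraft_apply_of_ball IsBall InBall ballU W hdisj hv (hq b hb)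

variable (C : Plaq P 0 → Prop)

/-- A `C`-plaquette that is not deep is a base-field plaquette, given boundary agreement of the ball fields on such plaquettes. [cite: Balaban1985Averaging, (9) p.19] -/
theorem plaqHol_ballGraft_eq_of_not_deep
    (hagree : ∀ v, IsBall v → ∀ q, C q → ¬ Plaq.Deep IsBall InBall q → ∀ b, Plaq.HasBond q b → InBall v b → ballU v b = W b)
    {q : Plaq P 0} (hq : C q) (hnd : ¬ Plaq.Deep IsBall InBall q) : GaugeField.plaqHol (ballGraft IsBall InBall ballU W) q = GaugeField.plaqHol W q := by
  classical
  refine plaqHol_congr q fun b hb => ?_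
  by_cases h : ∃ v, IsBall v ∧ InBall v b
  · unfold ballGraft
    rw [dif_pos h]
    obtain ⟨hv, hvb⟩ := Classical.choose_spec h
    exact hagree _ hv q hq hnd b hb hvb
  · exact ballGraft_apply_of_not IsBall InBall ballU W h

/-- **★★ STAGE (B): EVERY `C`-PLAQUETTE IS `max(b_W, b_B)`-FLAT** if the base field is `b_W`-flat on the `C`-plaquettes that are not deep, the balls are disjoint, deep
`C`-plaquettes have `b_B`-flat ball plaquettes, and the ball fields agree with the base field on their bonds lying on non-deep `C`-plaquettes. [cite: Balaban1985Variational, (11)–(14) pp.279–280] -/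
theorem dist1_plaqHol_ballGraft_le {bW bB : ℝ} (hW : ∀ q, C q → ¬ Plaq.Deep IsBall InBall q → GaugeGroup.dist1 (GaugeField.plaqHol W q) ≤ bW)
    (hdisj : ∀ v v' b, IsBall v → IsBall v' → InBall v b → InBall v' b → v = v')
    (hdeep : ∀ v, IsBall v → ∀ q, C q → (∀ b, Plaq.HasBond q b → InBall v b) → GaugeGroup.dist1 (GaugeField.plaqHol (ballU v) q) ≤ bB)
    (hagree : ∀ v, IsBall v → ∀ q, C q → ¬ Plaq.Deep IsBall InBall q → ∀ b, Plaq.HasBond q b → InBall v b → ballU v b = W b)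
    (q : Plaq P 0) (hq : C q) :
    GaugeGroup.dist1 (GaugeField.plaqHol (ballGraft IsBall InBall ballU W) q) ≤ max bW bB := by
  by_cases hd : Plaq.Deep IsBall InBall q
  · obtain ⟨v, hv, hvq⟩ := hd
    rw [plaqHol_ballGraft_eq_of_deep IsBall InBall ballU W hdisj hv hvq]
    exact (hdeep v hv q hq hvq).trans (le_max_right _ _)
  · rw [plaqHol_ballGraft_eq_of_not_deep IsBall InBall ballU W C hagree hq hd]
    exact (hW q hq hd).trans (le_max_left _ _)

end Balls

/-! ## §4 The start field: balls ▹ tubes ▹ section -/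

section Start

variable {P : Params} {n : Type*} [Fintype n] [DecidableEq n] [Nonempty n] {k : ℕ}
variable (V : GaugeField P k (Matrix.specialUnitaryGroup n ℂ)) (Rt : ℕ) (Fp : Plaq P k → lieSU n) (tf : Plaq P k → (Fin P.d → ℤ) → Fin P.d → ℝ)
  (IsTube : Plaq P k → Prop) (IsBall : Site P 0 → Prop) (InBall : Site P 0 → PBond P 0 → Prop)
  (ballU : Site P 0 → GaugeField P 0 (Matrix.specialUnitaryGroup n ℂ))

/-- **THE START FIELD** `U⁰ := balls ▹ tubes ▹ section`. [cite: Balaban1985Variational, (11) p.279] -/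
def startU : GaugeField P 0 (Matrix.specialUnitaryGroup n ℂ) := ballGraft IsBall InBall ballU (tubeSec V Rt Fp tf IsTube)

variable (C : Plaq P 0 → Prop)

/-- **★★★ THE START FIELD IS `max(b_T, b_B)`-FLAT ON EVERY CONSTRAINED PLAQUETTE.**  Hypotheses: the chart fits the torus (`2·max(Rt, ⌊L^k∕2⌋) + 1 ≤ N₀`); stage (T) for the
predicate `C ∧ ¬Deep` — (A3) box containment, (A4) separation, (A5) coverage — and the tube budget; stage (B) — disjoint balls, `b_B`-flat deep plaquettes, boundary agreement.
[cite: Balaban1985Variational, (11)–(14) pp.279–280] -/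
theorem dist1_plaqHol_startU_le (hN : 2 * max Rt (P.L ^ k / 2) + 1 ≤ P.sitesPerDir 0) {bT bB : ℝ} (hbT : 0 ≤ bT)
    (hbox : ∀ Q, IsTube Q → ∀ q, C q → ¬ Plaq.Deep IsBall InBall q → (∃ b, Plaq.HasBond q b ∧ TubeActive V Rt Fp tf IsTube Q b) →
      ∃ u : Fin P.d → ℤ, q.src = boxSite (cornerSite k Q.src Q.μ Q.ν) u ∧ InTube Q.μ Q.ν Rt (P.L ^ k / 2) u ∧ InTube Q.μ Q.ν Rt (P.L ^ k / 2) (u + e q.μ) ∧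
        InTube Q.μ Q.ν Rt (P.L ^ k / 2) (u + e q.ν) ∧ InTube Q.μ Q.ν Rt (P.L ^ k / 2) (u + e q.μ + e q.ν))
    (hsep : ∀ Q Q' q, C q → ¬ Plaq.Deep IsBall InBall q → (∃ b, Plaq.HasBond q b ∧ TubeActive V Rt Fp tf IsTube Q b) →
      (∃ b, Plaq.HasBond q b ∧ TubeActive V Rt Fp tf IsTube Q' b) → Q = Q')
    (hcov : ∀ q, C q → ¬ Plaq.Deep IsBall InBall q → GaugeField.plaqHol (iterSec k V) q ≠ 1 → ∃ Q b, Plaq.HasBond q b ∧ TubeActive V Rt Fp tf IsTube Q b)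
    (htube : ∀ Q, IsTube Q → ∀ u α β, Real.exp (|curlB (tf Q) u α β| * ‖((Fp Q : lieSU n) : Matrix n n ℂ)‖) - 1 ≤ bT)
    (hdisj : ∀ v v' b, IsBall v → IsBall v' → InBall v b → InBall v' b → v = v')
    (hdeep : ∀ v, IsBall v → ∀ q, C q → (∀ b, Plaq.HasBond q b → InBall v b) → GaugeGroup.dist1 (GaugeField.plaqHol (ballU v) q) ≤ bB)
    (hagree : ∀ v, IsBall v → ∀ q, C q → ¬ Plaq.Deep IsBall InBall q → ∀ b, Plaq.HasBond q b → InBall v b → ballU v b = tubeSec V Rt Fp tf IsTube b)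
    (q : Plaq P 0) (hq : C q) :
    GaugeGroup.dist1 (GaugeField.plaqHol (startU V Rt Fp tf IsTube IsBall InBall ballU) q) ≤ max bT bB := by
  unfold startU
  refine dist1_plaqHol_ballGraft_le IsBall InBall ballU _ C (fun q' hq' hnd => ?_) hdisj hdeep hagree q hq
  exact dist1_plaqHol_tubeSec_le V Rt Fp tf IsTube (fun p => C p ∧ ¬ Plaq.Deep IsBall InBall p) hN hbT
    (fun Q hQ p hp hb => hbox Q hQ p hp.1 hp.2 hb) (fun Q Q' p hp hb hb' => hsep Q Q' p hp.1 hp.2 hb hb')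
    (fun p hp hne => hcov p hp.1 hp.2 hne) htube q' ⟨hq', hnd⟩

/-- **OFF THE BALLS AND THE ACTIVE TUBE BONDS THE START FIELD IS THE SECTION.** [cite: Balaban1985Variational, (11) p.279] -/
theorem startU_apply_of_quiet {b : PBond P 0} (hnb : ¬ ∃ v, IsBall v ∧ InBall v b) (hna : ¬ ∃ Q, TubeActive V Rt Fp tf IsTube Q b) :
    startU V Rt Fp tf IsTube IsBall InBall ballU b = iterSec k V b := by
  unfold startU
  rw [ballGraft_apply_of_not IsBall InBall ballU _ hnb, tubeSec_apply_of_quiet V Rt Fp tf IsTube hna]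

/-- On a bond of ball `v` the start field is the ball field. [folklore] -/
theorem startU_apply_of_ball (hdisj : ∀ v v' b, IsBall v → IsBall v' → InBall v b → InBall v' b → v = v') {v : Site P 0} {b : PBond P 0} (hv : IsBall v)
    (hb : InBall v b) : startU V Rt Fp tf IsTube IsBall InBall ballU b = ballU v b := by
  unfold startU
  exact ballGraft_apply_of_ball IsBall InBall ballU _ hdisj hv hb

/-- Off the balls the start field is stage (T). [folklore] -/
theorem startU_apply_of_not_ball {b : PBond P 0} (hnb : ¬ ∃ v, IsBall v ∧ InBall v b) :
    startU V Rt Fp tf IsTube IsBall InBall ballU b = tubeSec V Rt Fp tf IsTube b := by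
  unfold startU
  exact ballGraft_apply_of_not IsBall InBall ballU _ hnb

end Start

end Summit.QuantumFields.YangMills.Theorems.TubeStart

end
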